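/-
PORT (pub-hodgecm2, COR-CM cell) of the stage-1 package file `HodgeCMPerL/HodgeCM/Geometry/WeightFacts.lean`
(pub-hodgecm HOME/lean, bytes of record md5 8983beed2c02, 96 lines). Declarations VERBATIM; edits: imports rewritten to tree
modules, namespace token `HodgeCM` ↦ `Summit.HodgeConjecture.CorCM`, package `conjRingHomK` ↦ tree `Literature.NumberTheory.Automorphic.cmConjRingHom`
(definitionally equal bodies), linter fixes. Generator: pub-hodgecm2-p1 `work/port/build_kit.py`.
-/
import Summits.HodgeConjecture.CorCM.Geometry.WeightVectors

/-!
# Weight spaces of `A′ = ∏_j A_{(F,Θ_j)}` and the two model facts M29, M30 used by Pohlmann's span theorem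

The WEIGHT SPACE `weightSpace F Θ S k ⊆ H^k(A′, ℂ)` of a weight `S = (S_j)_j` (`S_j ⊆ Hom(F, ℂ)`) is the
joint eigenspace `{x | IsWeightVector F Θ S k x}` of the factor-wise CM multiplications (`IsFactorAct`),
with eigencharacter `(j, a) ↦ ∏_{s ∈ S_j} s(a)`.

In the intended model `H^•(A′, ℚ) = ⋀^• H¹(A′, ℚ)`, `H¹(A′) = ⊕_j pr_j^* H¹(A_{Θ_j})` (Künneth) and
`H¹(A_{Θ_j}) ⊗ ℂ = ⊕_{s : F → ℂ} ℂ·e_{j,s}` with `a ∈ F` acting on `e_{j,s}` by `s(a)` and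
`H^{1,0}(A_{Θ_j}) = ⊕_{s ∈ Θ_j} ℂ·e_{j,s}` (the CM-type condition, M12 `Fact_alphaLine`).  Hence
`H^k(A′, ℂ)` has the basis of HODGE MONOMIALS `e_S = ⋀_{(j,s) ∈ S} e_{j,s}` (`Σ_j |S_j| = k`), `e_S` is a
weight vector of weight `S`, distinct `S` have distinct eigencharacters already on `𝓞_F`
(`Summit.HodgeConjecture.CorCM.Pohlmann.exists_separating_family`), and `e_S` has Hodge type
`(#{(j,s) ∈ S | s ∈ Θ_j}, #{(j,s) ∈ S | s ∉ Θ_j})`.  This is the content of the two standard facts below: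

* M29 `Fact_weightSpan`  — the weight spaces span `H^k(A′, ℂ)`;
* M30 `Fact_weightHodge` — the weight space of `S` lies in the Hodge piece `H^{p_S, q_S}`,
  `p_S = Σ_j Σ_{s ∈ S_j} 1_{Θ_j}(s)`, `q_S = Σ_j Σ_{s ∈ S_j} (1 - 1_{Θ_j}(s))` (so it is `0` unless
  `Σ_j |S_j| = k`).

Sources (page level): Gao–Ullmo, *J. Inst. Math. Jussieu* 25 (2025) 215–249 = arXiv:2411.12249, §3.1,
p. 9 lines 17–30 ("`H^r(A, ℂ) = ⋀^r ℂ^{Hom(E,ℂ)}`, `H^{1,0} = Σ_{φ ∈ Φ} ℂφ`, `H^{p,q}(A)` has the basis `[P]`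
with `|P ∩ Φ| = p`, `|P ∩ Φ̄| = q`"); Pohlmann, *Ann. of Math.* 88 (1968) 161–180, §1; Deligne (Milne),
LNM 900 (1982), §4 pp. 47–50; Mumford, *Abelian Varieties* §1 (`H^•(A) = ⋀^• H¹(A)`) and §22.
They are consumed as explicit hypotheses `(h29 : U.Fact_weightSpan) (h30 : U.Fact_weightHodge)` by
`Summit.HodgeConjecture.CorCM.Universe.pohlmannSpan_holds` until they join `ModelAxioms` (packager's call; FACTS.md rows
M29/M30 proposed in `HOME/pub-hodgecm-pohl/FACTS-M29-M30.md`).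
-/

noncomputable section

open scoped TensorProduct

namespace Summit.HodgeConjecture.CorCM

open Literature.AlgebraicGeometry.Motives (CMType HodgeStructure)

namespace Universe

variable (U : Universe)

/-- The **weight space** of the weight `S = (S_j)_j` in `H^k(A′, ℂ)`, `A′ = ∏_j A_{(F,Θ_j)}`: the joint
eigenspace of the factor-wise CM multiplications with eigencharacter `(j,a) ↦ ∏_{s ∈ S_j} s(a)`
(`= {x | IsWeightVector F Θ S k x}`; in the model `= ℂ·e_S` if `Σ_j |S_j| = k`, else `0`). -/
def weightSpace (F : CMField) {n : ℕ} (Θ : Fin (n + 1) → CMType F)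
    (S : Fin (n + 1) → Finset ((F : Type) →+* ℂ)) (k : ℕ) : Submodule ℂ (U.CohC (U.cmProd F Θ) k) where
  carrier := {x | U.IsWeightVector F Θ S k x}
  add_mem' := by
    intro x y hx hy j a M hM
    rw [map_add, hx j a M hM, hy j a M hM, smul_add]
  zero_mem' := by
    intro j a M hM
    rw [map_zero, smul_zero]
  smul_mem' := by
    intro c x hx j a M hM
    rw [map_smul, hx j a M hM, smul_comm]

variable {U} in
/-- Membership in the weight space of `S` is the weight-vector condition `IsWeightVector F Θ S k` (definitional). -/
@[simp] theorem mem_weightSpace_iff (F : CMField) {n : ℕ} (Θ : Fin (n + 1) → CMType F)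
    (S : Fin (n + 1) → Finset ((F : Type) →+* ℂ)) (k : ℕ) (x : U.CohC (U.cmProd F Θ) k) :
    x ∈ U.weightSpace F Θ S k ↔ U.IsWeightVector F Θ S k x :=
  Iff.rfl

/-- **M29 — Hodge monomials span.** `H^k(∏_j A_{(F,Θ_j)}, ℂ)` is the sum of its weight spaces
(in the model: the Hodge monomials `e_S`, `Σ_j |S_j| = k`, form a basis of `H^k = ⋀^k ⊕_{j,s} ℂ e_{j,s}`).
[Gao–Ullmo 2025 §3.1 p. 9 ll. 17–22; Pohlmann 1968 §1; Deligne LNM 900 §4; Mumford §1] -/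
def Fact_weightSpan : Prop :=
  ∀ (F : CMField) (n : ℕ) (Θ : Fin (n + 1) → CMType F) (k : ℕ), ⨆ S, U.weightSpace F Θ S k = ⊤

/-- **M30 — Hodge type of a Hodge monomial.** The weight space of `S` lies in the Hodge piece
`H^{p_S,q_S}` with `p_S = #{(j,s) ∈ S | s ∈ Θ_j}`, `q_S = #{(j,s) ∈ S | s ∉ Θ_j}` (in the model:
`e_{j,s} ∈ H^{1,0}(A_{Θ_j})` iff `s ∈ Θ_j` — the CM-type condition — and Hodge types add under `∧`; distinct
weights are separated by `𝓞_F`, so the weight space of `S` is `ℂ e_S` or `0`).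
[Gao–Ullmo 2025 §3.1 p. 9 ll. 23–30; Pohlmann 1968 §1; Deligne LNM 900 §4; Mumford §22] -/
def Fact_weightHodge : Prop :=
  ∀ (F : CMField) (n : ℕ) (Θ : Fin (n + 1) → CMType F) (k : ℕ)
    (S : Fin (n + 1) → Finset ((F : Type) →+* ℂ)),
    U.weightSpace F Θ S k ≤
      (U.hodge (U.cmProd F Θ) k).piece (∑ j, ∑ s ∈ S j, ind (Θ j) s)
        (∑ j, ∑ s ∈ S j, (1 - ind (Θ j) s))

end Universe

end Summit.HodgeConjecture.CorCM

end
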